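import Mathlib

/-!
# SoloBlind — the Das representative of the Kubert 2-class at level `4p`: denominator counts (THEOREM G)

Companion of `SoloBlindLevel52` / `SoloBlindLevelRaising44`; certificates behind `paper/hafnian-theorem.md`
§11.7 (b″) of the solo-blind programme on the Kontsevich–Zagier conjecture.

For an odd prime `p` the torsion of `U_{4p}/(reflections + multiplication relations)` is `ℤ/2` (Kubert),
generated by the Das class of `{2, p}`.  Anderson's canonical representative (Duke Math. J. 114 (2002),
"Kronecker–Weber plus epsilon", 4.3.2) is the formal combination of symbols `[k/(4p)]`
  `a_{2p} = [p/4p] − Σ_{k=0}^{(p−1)/2} [(4k+1)/4p] − Σ_{j=1}^{(p−1)/2} ([4j/4p] + [(4j−2)/4p] − [2j/4p] − [(2j−1)/4p])`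
(all numerators lie in `1 … 2p−1 < 4p`).  We encode it by its pairing `dasPair p w` with an arbitrary
weight `w : ℕ → ℤ` on numerators (index `j = i + 1`).  Two orbit counts decide which invariant functional
sees the class:
* numerators `k` with `4 ∣ k` are exactly the symbols of reduced denominator `p` (weight `denP`);
* numerators `k` with `p ∣ k`, `k` odd, are exactly the symbols of reduced denominator `4` (weight `den4 p`).
Main results (all `p`, no computation):
* `dasPair_denP`: the signed number of denominator-`p` symbols is `⌊(p−1)/4⌋ − (p−1)/2`, i.e. minus the
  Gauss-lemma count for the residue `2`; `denP_even_iff`, `denP_even_iff_isSquare_two`: it is even iff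
  `p ≡ ±1 (mod 8)` iff `2` is a square mod `p`.
* `dasPair_den4`, `den4_even_iff_isSquare_neg_one`: the signed number of denominator-`4` symbols is `0` for
  `p ≡ 1 (mod 4)` and `1` for `p ≡ 3 (mod 4)`, i.e. even iff `−1` is a square mod `p`.
Since both counts are parities of functionals vanishing on the relation module at level `4p` (paper, PROP 2C),
this is THEOREM G: `f_p(α_{4p}) = [(2/p) = −1]`, `ψ₄(α_{4p}) = [(−1/p) = −1]`; equivalently
`(−1)^{v_p(sin a_{2p})} = (2/p)`, the `{2,p}` companion of Seo's formula `(−1)^{v_q(sin a_{pq})} = (p/q)`.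
Finite certificates (`decide +kernel`, `p < 50`): the list form `dasRep p` is a Koblitz–Ogus unit of level `4p`
(all Koblitz–Ogus sums `S_u = −(p−1)/4`; property KO(p)), its two counts agree with the formulas, both counts are
even on every reflection and multiplication relation of level `4p`, and one of them is odd on `a_{2p}` unless
`p ≡ 1 (mod 8)` — so `a_{2p}` lies outside the relation module (property ND(p)) for `p < 50`, `p ≠ 17, 41`.
-/

namespace Summit.KontsevichZagierPeriods.KontsevichZagierPeriods.Theorems
namespace SoloBlind
namespace DasClass

open Finset

/-- Pairing of Anderson's representative `a_{2p}` with a weight `w` on numerators `k` of `k/(4p)`: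
`w(p) − Σ_{k ≤ (p−1)/2} w(4k+1) − Σ_{i < (p−1)/2} (w(4i+4) + w(4i+2) − w(2i+2) − w(2i+1))`. -/
def dasPair (p : ℕ) (w : ℕ → ℤ) : ℤ :=
  w p - (∑ k ∈ range ((p - 1) / 2 + 1), w (4 * k + 1))
    - ∑ i ∈ range ((p - 1) / 2), (w (4 * i + 4) + w (4 * i + 2) - w (2 * i + 2) - w (2 * i + 1))

/-- Indicator of the numerators of reduced denominator `p` at level `4p`: `4 ∣ k`. -/
def denP (k : ℕ) : ℤ := if k % 4 = 0 then 1 else 0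

/-- Indicator of the numerators of reduced denominator `4` at level `4p`: `p ∣ k`, `k` odd. -/
def den4 (p k : ℕ) : ℤ := if k % p = 0 ∧ k % 2 = 1 then 1 else 0

/-- `#{i < n : i odd}` as a sum of indicators of `4 ∣ 2i+2`. -/
theorem sum_ind_even (n : ℕ) :
    (∑ i ∈ range n, (if (2 * i + 2) % 4 = 0 then (1 : ℤ) else 0)) = ((n / 2 : ℕ) : ℤ) := by
  induction n with
  | zero => simp
  | succ n ih =>
    rw [sum_range_succ, ih]
    split_ifs with h <;> push_cast <;> omega

/-- The signed count of denominator-`p` symbols in `a_{2p}` (any odd `p`): `⌊(p−1)/4⌋ − (p−1)/2`. -/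
theorem dasPair_denP (p : ℕ) (hp : p % 2 = 1) :
    dasPair p denP = (((p - 1) / 4 : ℕ) : ℤ) - (((p - 1) / 2 : ℕ) : ℤ) := by
  have h1 : denP p = 0 := by
    unfold denP; rw [if_neg]; omega
  have h2 : (∑ k ∈ range ((p - 1) / 2 + 1), denP (4 * k + 1)) = 0 := by
    refine sum_eq_zero fun k _ => ?_
    unfold denP; rw [if_neg]; omega
  have h3 : (∑ i ∈ range ((p - 1) / 2),
      (denP (4 * i + 4) + denP (4 * i + 2) - denP (2 * i + 2) - denP (2 * i + 1)))
      = ∑ i ∈ range ((p - 1) / 2), ((1 : ℤ) - (if (2 * i + 2) % 4 = 0 then (1 : ℤ) else 0)) := by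
    refine sum_congr rfl fun i _ => ?_
    unfold denP
    have e1 : (4 * i + 4) % 4 = 0 := by omega
    have e2 : ¬ (4 * i + 2) % 4 = 0 := by omega
    have e3 : ¬ (2 * i + 1) % 4 = 0 := by omega
    rw [if_pos e1, if_neg e2, if_neg e3]
    ring
  rw [dasPair, h1, h2, h3, sum_sub_distrib, sum_ind_even, sum_const, card_range, nsmul_eq_mul, mul_one]
  push_cast
  omega

/-- Parity: the denominator-`p` count is even iff `p ≡ ±1 (mod 8)` (Gauss's lemma for the residue `2`). -/
theorem denP_even_iff (p : ℕ) (hp : p % 2 = 1) :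
    Even (dasPair p denP) ↔ (p % 8 = 1 ∨ p % 8 = 7) := by
  rw [dasPair_denP p hp, Int.even_iff]
  omega

/-- THEOREM G (i): for an odd prime `p`, the denominator-`p` count of `a_{2p}` is even iff `2` is a square
mod `p`; i.e. `f_p(α_{4p}) = [(2/p) = −1]`. -/
theorem denP_even_iff_isSquare_two (p : ℕ) [Fact p.Prime] (hp : p ≠ 2) :
    Even (dasPair p denP) ↔ IsSquare (2 : ZMod p) := by
  rw [denP_even_iff p ((Nat.Prime.mod_two_eq_one_iff_ne_two Fact.out).mpr hp),
    ZMod.exists_sq_eq_two_iff hp]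

/-- A multiple of `p` strictly between `0` and `2p` is `p`. -/
theorem eq_of_dvd_of_lt_two_mul {p m : ℕ} (h : p ∣ m) (h0 : 0 < m) (h2 : m < 2 * p) : m = p := by
  obtain ⟨c, rfl⟩ := h
  have hc : c < 2 := by
    by_contra hc
    rw [not_lt] at hc
    have := Nat.mul_le_mul_left p hc
    omega
  interval_cases c <;> simp_all

/-- The signed count of denominator-`4` symbols in `a_{2p}` (odd prime `p`): `0` if `p ≡ 1 (mod 4)`
(the symbol `[(4k+1)/4p]` with `k = (p−1)/4` cancels `[1/4]`), `1` otherwise. -/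
theorem dasPair_den4 (p : ℕ) (hpr : p.Prime) (hp : p ≠ 2) :
    dasPair p (den4 p) = if p % 4 = 1 then 0 else 1 := by
  have hodd : p % 2 = 1 := (Nat.Prime.mod_two_eq_one_iff_ne_two hpr).mpr hp
  have hp1 : 1 < p := hpr.one_lt
  have h1 : den4 p p = 1 := by
    unfold den4; rw [if_pos]; exact ⟨Nat.mod_self p, hodd⟩
  have h3 : (∑ i ∈ range ((p - 1) / 2),
      (den4 p (4 * i + 4) + den4 p (4 * i + 2) - den4 p (2 * i + 2) - den4 p (2 * i + 1))) = 0 := by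
    refine sum_eq_zero fun i hi => ?_
    rw [mem_range] at hi
    have e4 : (2 * i + 1) % p = 2 * i + 1 := Nat.mod_eq_of_lt (by omega)
    unfold den4
    rw [if_neg, if_neg, if_neg, if_neg] <;> [ring; (rw [e4]; omega); omega; omega; omega]
  -- the middle sum: exactly one symbol `(4k+1)/4p` has `p ∣ 4k+1`, namely `4k+1 = p`, iff `p ≡ 1 (mod 4)`
  have key : ∀ k, k < (p - 1) / 2 + 1 → ((4 * k + 1) % p = 0 ↔ (p % 4 = 1 ∧ k = (p - 1) / 4)) := by
    intro k hk
    constructor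
    · intro h
      have hm := eq_of_dvd_of_lt_two_mul (Nat.dvd_of_mod_eq_zero h) (by omega) (by omega)
      omega
    · rintro ⟨h4, rfl⟩
      have : 4 * ((p - 1) / 4) + 1 = p := by omega
      rw [this, Nat.mod_self]
  have h2 : (∑ k ∈ range ((p - 1) / 2 + 1), den4 p (4 * k + 1)) = if p % 4 = 1 then 1 else 0 := by
    split_ifs with h4
    · rw [sum_eq_single ((p - 1) / 4)]
      · unfold den4; rw [if_pos]; exact ⟨(key _ (by omega)).mpr ⟨h4, rfl⟩, by omega⟩
      · intro k hk hne
        rw [mem_range] at hk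
        unfold den4; rw [if_neg]
        rintro ⟨h, _⟩
        exact hne ((key k hk).mp h).2
      · intro hn; exact absurd (mem_range.mpr (by omega)) hn
    · refine sum_eq_zero fun k hk => ?_
      rw [mem_range] at hk
      unfold den4; rw [if_neg]
      rintro ⟨h, _⟩
      exact h4 ((key k hk).mp h).1
  rw [dasPair, h1, h2, h3]
  split_ifs <;> simp

/-- THEOREM G (ii): the denominator-`4` count of `a_{2p}` is even iff `p ≡ 1 (mod 4)` iff `−1` is a square
mod `p`; i.e. `ψ₄(α_{4p}) = [(−1/p) = −1]`. -/
theorem den4_even_iff_isSquare_neg_one (p : ℕ) [Fact p.Prime] (hp : p ≠ 2) :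
    Even (dasPair p (den4 p)) ↔ IsSquare (-1 : ZMod p) := by
  have hodd : p % 2 = 1 := (Nat.Prime.mod_two_eq_one_iff_ne_two Fact.out).mpr hp
  rw [dasPair_den4 p Fact.out hp, ZMod.exists_sq_eq_neg_one_iff]
  split_ifs with h <;> simp <;> omega

/-! ### Finite certificates: `a_{2p}` is a Koblitz–Ogus unit of level `4p` (`p < 50`) -/

/-- A Γ-monomial of level `N` as a list of (index, exponent) pairs. -/
abbrev GammaMonomial := List (ℕ × ℤ)

/-- Koblitz–Ogus sum `N · S_u(e) = Σ e_k · (u k mod N)`. -/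
def koSumOf (N u : ℕ) (e : GammaMonomial) : ℤ :=
  e.foldl (fun acc kc => acc + kc.2 * (((u * kc.1) % N : ℕ) : ℤ)) 0

/-- The units mod `N` in `1 … N-1`. -/
def unitsMod (N : ℕ) : List ℕ := (List.range N).filter fun u => Nat.gcd u N == 1

/-- Anderson's representative `a_{2p}` as a Γ-monomial of level `4p` (same symbols as `dasPair`). -/
def dasRep (p : ℕ) : GammaMonomial :=
  ((p, (1 : ℤ)) :: (List.range ((p - 1) / 2 + 1)).map fun k => (4 * k + 1, (-1 : ℤ)))
  ++ (List.range ((p - 1) / 2)).flatMap fun i =>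
    [(4 * i + 4, (-1 : ℤ)), (4 * i + 2, -1), (2 * i + 2, 1), (2 * i + 1, 1)]

/-- Pairing of the list form with a weight. -/
def listPair (e : GammaMonomial) (w : ℕ → ℤ) : ℤ := e.foldl (fun acc kc => acc + kc.2 * w kc.1) 0

/-- The odd primes below `50`. -/
def smallPrimes : List ℕ := [3, 5, 7, 11, 13, 17, 19, 23, 29, 31, 37, 41, 43, 47]

/-- KO(p) for `p < 50`: `a_{2p}` is a Koblitz–Ogus unit of level `4p` with all sums `S_u = −(p−1)/4` (here
scaled by `4p`: `−p(p−1)`) — so `Γ(a_{2p})` is an algebraic multiple of a power of `π` (Koblitz–Ogus/Deligne). -/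
theorem koUnit_small : (smallPrimes.all fun p =>
    (unitsMod (4 * p)).all fun u => koSumOf (4 * p) u (dasRep p) == -((p : ℤ) * (p - 1))) = true := by
  decide +kernel

/-- Cross-check of the list form against the closed formulas for `p < 50`:
denominator-`p` count `= ⌊(p−1)/4⌋ − (p−1)/2`, denominator-`4` count `= [p % 4 ≠ 1]`. -/
theorem counts_small : (smallPrimes.all fun p =>
    listPair (dasRep p) denP == (((p - 1) / 4 : ℕ) : ℤ) - (((p - 1) / 2 : ℕ) : ℤ) &&
    listPair (dasRep p) (den4 p) == (if p % 4 = 1 then 0 else 1)) = true := by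
  decide +kernel

/-! ### Finite certificates: the two counts vanish mod 2 on the relation module (`p < 50`)

`parityEven N P e` is the parity functional `Σ_{N ∤ k, P (k mod N)} e_k (mod 2)`.  With `P = (4 ∣ ·)` it is
`f_p` (reduced denominator `p`), with `P = (p ∣ ·) ∧ odd` it is `ψ₄` (reduced denominator `4`).  Both are even
on every reflection `e_k + e_{N−k}` and every multiplication relation of level `N = 4p`; together with
`counts_small` this certifies `a_{2p} ∉ W_{4p}` (property ND(p)) for every `p < 50` with `p ≢ 1 (mod 8)`. -/

/-- Parity functional `Σ_{N ∤ k, P (k mod N)} e_k ≡ 0 (mod 2)`? -/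
def parityEven (N : ℕ) (P : ℕ → Bool) (e : GammaMonomial) : Bool :=
  (e.foldl (fun acc kc => if kc.1 % N != 0 && P (kc.1 % N) then acc + kc.2 else acc) 0) % 2 == 0

/-- Reflection generators `e_k + e_{N-k}`, `1 ≤ k ≤ N/2`. -/
def reflGens (N : ℕ) : List GammaMonomial :=
  ((List.range (N / 2)).map fun i => [(i + 1, (1 : ℤ)), (N - (i + 1), 1)])

/-- Gauss multiplication generators `Σ_{j<d} e_{k + jN/d} - e_{dk}` for `d ∣ N`, `d > 1`, `1 ≤ k < N/d`. -/
def multGens (N : ℕ) : List GammaMonomial :=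
  (((List.range (N + 1)).filter fun d => 1 < d && N % d == 0).map fun d =>
    (List.range (N / d - 1)).map fun i =>
      let k := i + 1
      ((List.range d).map fun j => (k + j * (N / d), (1 : ℤ))) ++ [(d * k, (-1 : ℤ))]).flatten

/-- The multiplication relations at `k = 0`: `Σ_{0<j<d} e_{jN/d}`, `d ∣ N`, `d > 1`. -/
def multGensZero (N : ℕ) : List GammaMonomial :=
  ((List.range (N + 1)).filter fun d => 1 < d && N % d == 0).map fun d =>
    ((List.range (d - 1)).map fun j => ((j + 1) * (N / d), (1 : ℤ)))

/-- `f_p` (denominator exactly `p`, i.e. `4 ∣ k`) and `ψ₄` (denominator exactly `4`, i.e. `p ∣ k`, `k` odd)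
are even on all reflections and all multiplication relations of level `4p`, `p < 50`. -/
theorem functionals_even_small : (smallPrimes.all fun p =>
    (reflGens (4 * p) ++ multGens (4 * p) ++ multGensZero (4 * p)).all fun g =>
      parityEven (4 * p) (fun k => k % 4 == 0) g && parityEven (4 * p) (fun k => k % p == 0 && k % 2 == 1) g)
    = true := by
  decide +kernel

/-- … while on `a_{2p}` itself `f_p` is odd iff `p ≡ ±3 (mod 8)` and `ψ₄` is odd iff `p ≡ 3 (mod 4)`
(`p < 50`); in particular one of them is odd — so `a_{2p} ∉ W_{4p}` — unless `p ≡ 1 (mod 8)` (`p = 17, 41`). -/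
theorem dasRep_parities_small : (smallPrimes.all fun p =>
    (parityEven (4 * p) (fun k => k % 4 == 0) (dasRep p) == !(p % 8 == 3 || p % 8 == 5)) &&
    (parityEven (4 * p) (fun k => k % p == 0 && k % 2 == 1) (dasRep p) == !(p % 4 == 3))) = true := by
  decide +kernel

end DasClass
end SoloBlind
end Summit.KontsevichZagierPeriods.KontsevichZagierPeriods.Theorems
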